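import Summits.ValiantsHypothesis.ValiantsHypothesis.Theorems.SOSBilinearCalibration
import Mathlib
import HarnessLib

/-!
# Calibrating the sum-of-squares road, II: the exact transfer `B = ⌈S/2⌉` and the
# characteristic-two collapse `¬ SOSBilinearSuperlinear`

Sequel to `SOSBilinearCalibration` (workshop `decomp-valiant`, lens 6, gen 33; CALL O-L6-9, part F1b).
With `B_F = HWY10.bilinearComplexity` and `S_F = SOSBilinearCalibration.sqComplexity`:

* §4 THE TRANSFER over a field with `2 ≠ 0` containing `c` with `c² = -1` (e.g. `ℂ`): pairing squares
  `z² + w² = (z + c w)(z - c w)` (`pair_rep`, any commutative ring: `n` squares are `⌈n/2⌉` products) and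
  halving products `z z' = ((z+z')/2)² + (c(z-z')/2)²` (`sqRep_of_rep`: `m` products are `2m` squares)
  give **`B_F(f) = ⌈S_F(f)/2⌉` for EVERY `f`** (`bilinearComplexity_eq_half`; for a non-representable `f`
  both infima are the junk value `0`). HWY state `B ≤ S ≤ 3B` (STOC Rem. 1.5) and `S/2 ≤ B ≤ S` (J. AMS
  Rem. 1.6, via `4 z z' = (z + z')² + (c(z - z'))²`); the kernel statement is the exact one. Consequence:
  the hypothesis of Thm 1.7 (`B_F(SOS_k)` superlinear) and that of Thm 1.4/1.6 (`S_F(k)` superlinear) are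
  the same statement up to the factor `2`.
* §5 CHARACTERISTIC TWO: `SOS_k = ((Σ x_i)(Σ y_j))²` (Frobenius on sums), so `S = B ≤ 1` for every `k`
  and **`¬ HWY10.SOSBilinearSuperlinear F` for every commutative ring `F` of characteristic `2`**
  (`not_sosBilinearSuperlinear_charTwo`).

Statement-audit datum, recorded without fanfare: the Literature definition `HWY10.SOSBilinearSuperlinear F`
carries no `char F ≠ 2` guard (HWY, p. 3: "the problem is not interesting if `F` has characteristic two,
for then `S_F(k) = 1`"; their Thm 1.8 carries `char F ≠ 2`), so it is FALSE in characteristic two and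
`HWY10_thm_1_7 F` is vacuously true there; the lineage's use over `ℂ` (`NcSOSRoad`, `NcSOSPermanent`)
is unaffected. HONEST FRAMING: classical identities (the pairing is Rem. 1.5's "if `F` contains a square
root of `-1` then clearly `S_F(k) ≥ B_F(k)`"), kernel-new; a CALIBRATION of the road's numeric hypothesis
— no lower bound on any circuit, nothing here bears on `VP ≠ VNP`.

## References
* [HrubesWigdersonYehudayoff2010] P. Hrubeš, A. Wigderson, A. Yehudayoff, Non-commutative circuits and
  the sum-of-squares problem, STOC 2010, 667–676 (p. 3 characteristic-two remark; §1.3 Rem 1.5; Thm 1.7,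
  Thm 1.8); J. Amer. Math. Soc. 24 (2011) 871–898, Remark 1.6 (`S_F ≤ 2 B_F`).
-/

noncomputable section

namespace Summit.ValiantsHypothesis.ValiantsHypothesis.Theorems.SOSBilinearHalf

open MvPolynomial
open Literature.Computability.AlgebraicComplexity
open Summit.ValiantsHypothesis.ValiantsHypothesis.Theorems.SOSBilinearCalibration

universe u

/-! ## §4 The transfer `B = ⌈S/2⌉`: pairing squares, halving products -/
section Transfer

variable {F : Type u} [CommRing F]

/-- **Pairing** (any commutative ring containing `c` with `c² = -1`): `n` squares of bilinear forms are
`⌈n/2⌉` products, by `z² + w² = (z + c w)(z - c w)`. [cite: HrubesWigdersonYehudayoff2010, Rem. 1.5] -/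
theorem pair_rep (c : F) (hc : c * c = -1) {k : ℕ} :
    ∀ (n : ℕ) (f : MvPolynomial (Fin k ⊕ Fin k) F) (z : Fin n → Fin k → Fin k → F),
      f = ∑ l, HWY10.bilinForm F (z l) ^ 2 →
      ∃ m, m ≤ (n + 1) / 2 ∧ ∃ a b : Fin m → Fin k → Fin k → F,
        f = ∑ l, HWY10.bilinForm F (a l) * HWY10.bilinForm F (b l)
  | 0, f, z, h => ⟨0, le_rfl, z, z, by rw [h]; simp⟩
  | 1, f, z, h => ⟨1, le_rfl, z, z, by rw [h]; simp only [Fin.sum_univ_one, sq]⟩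
  | n + 2, f, z, h => by
      obtain ⟨m, hm, a, b, hab⟩ := pair_rep c hc n
        (∑ l : Fin n, HWY10.bilinForm F (z l.succ.succ) ^ 2) (fun l => z l.succ.succ) rfl
      have hc' : (C c : MvPolynomial (Fin k ⊕ Fin k) F) * C c = -1 := by
        rw [← map_mul, hc, map_neg, map_one]
      refine ⟨m + 1, by omega, Fin.cons (z 0 + c • z (Fin.succ 0)) a,
        Fin.cons (z 0 + (-c) • z (Fin.succ 0)) b, ?_⟩
      rw [h, Fin.sum_univ_succ, Fin.sum_univ_succ, hab, Fin.sum_univ_succ]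
      simp only [Fin.cons_zero, Fin.cons_succ, NcSOSDegreeFour.bilinForm_add,
        NcSOSDegreeFour.bilinForm_smul, MvPolynomial.smul_eq_C_mul, map_neg]
      linear_combination (HWY10.bilinForm F (z (Fin.succ 0))) ^ 2 * hc'

/-- **Halving** (field with `2 ≠ 0` and `c² = -1`): `m` products of bilinear forms are `2m` squares, by
`z z' = ((z + z')/2)² + (c (z - z')/2)²` (HWY J. AMS Rem. 1.6: `4 z z' = (z + z')² + (c(z - z'))²`).
[cite: HrubesWigdersonYehudayoff2010, Rem. 1.5] -/
theorem sqRep_of_rep {K : Type u} [Field K] (h2 : (2 : K) ≠ 0) (c : K) (hc : c * c = -1) {k m : ℕ}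
    {f : MvPolynomial (Fin k ⊕ Fin k) K} (a b : Fin m → Fin k → Fin k → K)
    (h : f = ∑ l, HWY10.bilinForm K (a l) * HWY10.bilinForm K (b l)) :
    f = ∑ l : Fin (m + m), HWY10.bilinForm K (Fin.append (fun l => (2⁻¹ : K) • (a l + b l))
      (fun l => (c * 2⁻¹) • a l + (-(c * 2⁻¹)) • b l) l) ^ 2 := by
  have hc' : (C c : MvPolynomial (Fin k ⊕ Fin k) K) * C c = -1 := by
    rw [← map_mul, hc, map_neg, map_one]
  have h2' : (C (2⁻¹ : K) : MvPolynomial (Fin k ⊕ Fin k) K) * 2 = 1 := by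
    rw [← map_ofNat (C : K →+* MvPolynomial (Fin k ⊕ Fin k) K) 2, ← map_mul, inv_mul_cancel₀ h2,
      map_one]
  rw [Fin.sum_univ_add, h, ← Finset.sum_add_distrib]
  refine Finset.sum_congr rfl fun l _ => ?_
  simp only [Fin.append_left, Fin.append_right, NcSOSDegreeFour.bilinForm_add,
    NcSOSDegreeFour.bilinForm_smul, MvPolynomial.smul_eq_C_mul, map_neg, map_mul]
  linear_combination (-(C (2⁻¹ : K) ^ 2 * (HWY10.bilinForm K (a l) - HWY10.bilinForm K (b l)) ^ 2)) * hc'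
    + (-(HWY10.bilinForm K (a l) * HWY10.bilinForm K (b l)) * (2 * C (2⁻¹ : K) + 1)) * h2'

/-- **THE TRANSFER `B_F(f) = ⌈S_F(f)/2⌉`** for every `f`, over a field with `2 ≠ 0` containing `c`
with `c² = -1` (e.g. `ℂ`) — HWY's Remark (`S/2 ≤ B ≤ S`, J. AMS Rem. 1.6) made exact.
[cite: HrubesWigdersonYehudayoff2010, Rem. 1.5] -/
theorem bilinearComplexity_eq_half {K : Type u} [Field K] (h2 : (2 : K) ≠ 0) (c : K)
    (hc : c * c = -1) {k : ℕ} (f : MvPolynomial (Fin k ⊕ Fin k) K) :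
    HWY10.bilinearComplexity K f = (sqComplexity K f + 1) / 2 := by
  by_cases hS : ∃ (n : ℕ) (z : Fin n → Fin k → Fin k → K), f = ∑ l, HWY10.bilinForm K (z l) ^ 2
  · obtain ⟨n, z, hz⟩ := hS
    obtain ⟨w, hw⟩ := exists_sqRep_of_sqRep z hz
    obtain ⟨m, hm, a, b, hab⟩ := pair_rep c hc _ f w hw
    obtain ⟨a', b', hab'⟩ := exists_rep_of_rep a b hab
    have hB : HWY10.bilinearComplexity K f ≤ m := bilinearComplexity_le_of_rep a b hab
    have hS' := sqComplexity_le_of_rep _ (sqRep_of_rep h2 c hc a' b' hab')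
    omega
  · have hB : ¬ ∃ (m : ℕ) (a b : Fin m → Fin k → Fin k → K),
        f = ∑ l, HWY10.bilinForm K (a l) * HWY10.bilinForm K (b l) := by
      rintro ⟨m, a, b, hab⟩
      exact hS ⟨m + m, _, sqRep_of_rep h2 c hc a b hab⟩
    have e1 : HWY10.bilinearComplexity K f = 0 := by
      unfold HWY10.bilinearComplexity
      exact Nat.sInf_eq_zero.mpr (Or.inr (Set.eq_empty_iff_forall_notMem.mpr fun m hm => hB ⟨m, hm⟩))
    have e2 : sqComplexity K f = 0 := by
      unfold sqComplexity
      exact Nat.sInf_eq_zero.mpr (Or.inr (Set.eq_empty_iff_forall_notMem.mpr fun n hn => hS ⟨n, hn⟩))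
    rw [e1, e2]

/-- Hence for `SOS_k` (both infima attained): `S_F(SOS_k) ≤ 2·B_F(SOS_k) ≤ S_F(SOS_k) + 1`.
[cite: HrubesWigdersonYehudayoff2010, Rem. 1.5] -/
theorem sqComplexity_le_two_mul {K : Type u} [Field K] (h2 : (2 : K) ≠ 0) (c : K) (hc : c * c = -1)
    (k : ℕ) : sqComplexity K (HWY10.sosPoly K k) ≤ 2 * HWY10.bilinearComplexity K (HWY10.sosPoly K k) ∧
      2 * HWY10.bilinearComplexity K (HWY10.sosPoly K k) ≤ sqComplexity K (HWY10.sosPoly K k) + 1 := by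
  have := bilinearComplexity_eq_half h2 c hc (HWY10.sosPoly K k)
  omega

end Transfer

/-! ## §5 Characteristic two: `SOS_k = ((Σ x_i)(Σ y_j))²` -/
section CharTwo

variable (F : Type u) [CommRing F]

/-- The all-ones table gives `(Σ x_i)(Σ y_j)`. [cite: HrubesWigdersonYehudayoff2010, §1.3] -/
theorem bilinForm_one_eq (k : ℕ) : HWY10.bilinForm F (fun (_ _ : Fin k) => (1 : F)) =
    (∑ i : Fin k, X (Sum.inl i)) * ∑ j : Fin k, X (Sum.inr j) := by
  simp only [HWY10.bilinForm, one_smul, Finset.sum_mul_sum]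

variable [CharP F 2]

/-- In characteristic two `SOS_k` is ONE square of a bilinear form (Frobenius).
[cite: HrubesWigdersonYehudayoff2010, §1.2] -/
theorem sosPoly_eq_sq_charTwo (k : ℕ) :
    HWY10.sosPoly F k = ∑ l : Fin 1, HWY10.bilinForm F ((fun _ (_ _ : Fin k) => (1 : F)) l) ^ 2 := by
  rw [Fin.sum_univ_one, bilinForm_one_eq, HWY10.sosPoly, ← sum_pow_char 2 Finset.univ,
    ← sum_pow_char 2 Finset.univ]
  ring

/-- `S_F(SOS_k) ≤ 1` in characteristic two (HWY p. 3: "`S_F(k) = 1`"). [cite: HrubesWigdersonYehudayoff2010, §1.2] -/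
theorem sqComplexity_sosPoly_charTwo (k : ℕ) : sqComplexity F (HWY10.sosPoly F k) ≤ 1 :=
  sqComplexity_le_of_rep _ (sosPoly_eq_sq_charTwo F k)

/-- `B_F(SOS_k) ≤ 1` in characteristic two. [cite: HrubesWigdersonYehudayoff2010, §1.2] -/
theorem bilinearComplexity_sosPoly_charTwo (k : ℕ) :
    HWY10.bilinearComplexity F (HWY10.sosPoly F k) ≤ 1 :=
  bilinearComplexity_le_of_rep _ _ (rep_of_sqRep _ (sosPoly_eq_sq_charTwo F k))

/-- **STATEMENT-AUDIT DATUM.** The Literature conjecture `HWY10.SOSBilinearSuperlinear F` (typed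
without HWY's standing `char F ≠ 2`) is FALSE for every commutative ring of characteristic two:
`c·k^{1+ε} ≤ B_F(SOS_k) ≤ 1` fails at `k > 1/c`. [cite: HrubesWigdersonYehudayoff2010, Thm 1.8] -/
theorem not_sosBilinearSuperlinear_charTwo : ¬ HWY10.SOSBilinearSuperlinear F := by
  rintro ⟨ε, hε, c, hc, h⟩
  obtain ⟨k, hk⟩ := exists_nat_gt (1 / c)
  have hk0 : (0 : ℝ) < k := (one_div_pos.mpr hc).trans hk
  have hk1 : (1 : ℝ) ≤ k := Nat.one_le_cast.mpr (Nat.cast_pos.mp hk0)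
  have h1 : c * (k : ℝ) ^ (1 + ε) ≤ 1 :=
    (h k).trans (by exact_mod_cast bilinearComplexity_sosPoly_charTwo F k)
  have hpow : (k : ℝ) ≤ (k : ℝ) ^ (1 + ε) := by
    conv_lhs => rw [← Real.rpow_one (k : ℝ)]
    exact Real.rpow_le_rpow_of_exponent_le hk1 (by linarith)
  have h3 : c * (1 / c) = 1 := mul_one_div_cancel hc.ne'
  nlinarith [mul_le_mul_of_nonneg_left hpow hc.le, mul_lt_mul_of_pos_left hk hc]

end CharTwo

end Summit.ValiantsHypothesis.ValiantsHypothesis.Theorems.SOSBilinearHalf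

end
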